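import Summits.Ventures.HSemireg.UntwistCocycleTwistEquivalence
import Summits.Ventures.HSemireg.UntwistCocycleTwistLocal
import Literature.AlgebraicGeometry.Modules.RankOneCocycle
import HarnessLib

/-!
# Venture HSemireg — route R1.0 (untwisted reading): WHICH TWIST — the cocycle twist `E⟨c⟩ = E ⊗ lineBundle c`
# depends only on the CLASS `[c] ∈ Ȟ¹(X, 𝒪_X^×)` (th-4 file #30; sequel of files #11, #12, #14, #15)

HONEST FRAMING. A construction on the real carriers of `UntwistCocycleTwist.lean` (#11) in Mathlib's abelian category
`X.Modules` of all sheaves of `𝒪_X`-modules on an arbitrary scheme `X`; every input is DATA (a Čech coboundary), there is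
no hypothesis on `X` or on the module. Nothing is asserted about any variety; no gerbe; nothing here says HC, HC_CM or
HC_AV is proved.

WHAT AND WHY. Route R1.0 of `general-structure/PERRY-SUBSTITUTE-GS.md` untwists by «`L⁻¹`, `L` a square root of `P`» — a
CLASS in `Pic`; the untwisted reading of record (lead R-49(a)/R-51(a)) is `E₀′ = E₀ ⊗ M_B`, `M_B` the line bundle of the
integral `B`-field class. In the tree the twist is the CONSTRUCTED functor `E ↦ E⟨c⟩ = CocycleTwist.twist c E` (#11/#12)
of a cocycle REPRESENTATIVE `c = (U_x, g_{xy})` (`Modules/UnitCocycle.lean`: a Čech `1`-cocycle of units on a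
point-indexed open cover), and `𝒪_X⟨c⟩ ≅ lineBundle c` (#15) pins the twisting line bundle. This file proves that the
construction sees neither the representative nor the cover: for a Čech COBOUNDARY `b : UnitCocycle.Coboundary c c′`
(invertible `λ_x ∈ 𝒪_X(W_x)` on a common point-indexed refinement `W_x ≤ U_x ∩ U′_x` with `g′_{xy} λ_y = λ_x g_{xy}`,
i.e. `[c] = [c′]` in `CechPic X = Ȟ¹(X, 𝒪_X^×)`, Hartshorne III Ex. 4.5)

* `twistCongr b E : twist c E ≅ twist c′ E` for EVERY `𝒪_X`-module `E`, CONSTRUCTED by gluing (`Modules/SheafHom.glueHom`,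
  `Modules/RankOneCocycle.isoOfOverCover` — the device of `Modules/RankOneCocycleIso.nonempty_iso_of_coboundary`, which is
  the case `E = 𝒪_X`) the local isomorphisms
  `cobLocalHom b E x : (E⟨c⟩)|_{W_x} ≅ E|_{W_x} —(λ_x ·)→ E|_{W_x} ≅ (E⟨c′⟩)|_{W_x}` (#14 `twistTrivOver`,
  `Modules/SheafHom.overScalar`), which agree on `W_x ∩ W_y` BECAUSE `g′_{zx} λ_x g_{xy} = g′_{zx} g′_{xy} λ_y = g′_{zy} λ_y`
  — exactly the coboundary relation (`cobLocalHom_compatible`); section formula `twistCongr_hom_app` (on `V ≤ W_x` the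
  image of `s` is `(λ_x · s_x) ⊗ t′_x`, the section of `E⟨c′⟩` with `x`-coordinate `λ_x · s_x`);
* naturality in `E` (`twistCongr_hom_naturality`) and the isomorphism of twist FUNCTORS
  `twistFunctorCongr b : twistFunctor X c ≅ twistFunctor X c′`;
* corollaries: `nonempty_twist_iso_of_equiv` / `_of_mk_eq_mk` (`[c] = [c′] ⇒ E⟨c⟩ ≅ E⟨c′⟩`: up to isomorphism the twist
  factors through `CechPic X`) and COVER INDEPENDENCE `twistRefineIso` (`E⟨c⟩ ≅ E⟨c|_W⟩` for the same transition
  functions on any point-indexed refinement `W_x ≤ U_x`, `refineCocycle`).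

Sequels: the TRIVIAL CLASS `E⟨1⟩ ≅ E` (`UntwistCocycleTwistOne.lean`, #31) and the semiregularity consequences («the
verdict for `E₀ ⊗ M_B` depends only on the Picard class of `M_B`», sheaf and complex carriers;
`UntwistCocycleTwistClassSigma.lean`, #32) — kept apart so that this file stays below the size cap with light imports.

NUMBERS (the intended instance; nothing of it is used here): `X = X₀ = A₀` the `g = 4` anchor, `[c] = [M_B] ∈ Pic A₀`,
`c₁(M_B) = B₀ = c₁(P)/2` (integral iff `m` even, t-12), `E = E₀` termwise; which Ext groups:
`Ext²(E₀⟨c⟩, E₀⟨c⟩) ≅ Ext²(E₀⟨c′⟩, E₀⟨c′⟩)` (`18` at the anchor) by conjugation with `twistCongr`; which class: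
`[c] = [c′] ∈ Ȟ¹(A₀, 𝒪^×)`; which twist: `- ⊗ lineBundle c ≅ - ⊗ lineBundle c′`.

## Contents (everything proved; 0 named facts; 0 sorry)

* §1 `unitScalarIso`, `cobLocalHom`, `appLE_cobLocalHom`, `cobLocalHom_compatible`, `cobLocalHom_comp_symm`,
  `twistCongrOver`, **`twistCongr`**, `twistCongr_hom_app`, `twistCongr_inv_app`;
* §2 `appLE_cobLocalHom_twistMap`, `twistCongr_hom_naturality`, **`twistFunctorCongr`**;
* §3 `nonempty_twist_iso_of_equiv`, `nonempty_twist_iso_of_mk_eq_mk`, `refineCocycle`, `refineCoboundary`,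
  `mk_refineCocycle`, **`twistRefineIso`**.

## References

* R. Hartshorne, *Algebraic Geometry*, GTM 52 (1977), II Ex. 1.22 (glueing sheaves and their morphisms), III §4 and
  III Ex. 4.4–4.5 (Čech cocycles, refinements, `Pic X ≅ Ȟ¹(X, 𝒪_X^×)`). [Hartshorne1977]
* The Stacks Project, Tag 00AK (glueing sheaves), Tag 01CR (invertible modules). [StacksProject]
-/

noncomputable section

open CategoryTheory AlgebraicGeometry TopologicalSpace Opposite

namespace Summit.Ventures.HSemireg

open Literature.AlgebraicGeometry.Modules

universe u

variable {X : Scheme.{u}}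

namespace CocycleTwist

/-! ### 1. The local isomorphisms `(E⟨c⟩)|_{W_x} ≅ (E⟨c′⟩)|_{W_x}` of a coboundary and their gluing -/

section Local

variable {c c' : UnitCocycle X} (b : UnitCocycle.Coboundary c c') (E : X.Modules)

/-- Restrictions of the `0`-cochain `λ` of a coboundary (Mathlib-map form of `Coboundary.map_lam`). [folklore] -/
theorem map_lam_apply (x : X) {V W : X.Opens} (h : V ≤ b.W x) (i : W ⟶ V) :
    X.presheaf.map i.op (b.lam x V h) = b.lam x W (i.le.trans h) :=
  b.map_lam x h i.le

/-- Restricting twice is restricting once, with the composite inclusion spelled `homOfLE` (so that section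
identities stated on `homOfLE _` rewrite after it). [folklore] -/
theorem presheaf_map_map_homOfLE (M : X.Modules) {W V Y : X.Opens} (l : V ⟶ W) (l' : Y ⟶ V) (s : Γ(M, W)) :
    M.presheaf.map l'.op (M.presheaf.map l.op s) = M.presheaf.map (homOfLE (l'.le.trans l.le)).op s :=
  presheaf_map_map M l l' s

/-- **Multiplication by a unit `a` of `𝒪_X(U)` is an automorphism of `M|_U`** (inverse: multiplication by `a⁻¹`).
[folklore] -/
def unitScalarIso (M : X.Modules) (U : X.Opens) (a a' : Γ(X, U)) (h : a * a' = 1) : M.over U ≅ M.over U where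
  hom := overScalar M U a
  inv := overScalar M U a'
  hom_inv_id := by rw [← overScalar_mul, mul_comm, h, overScalar_one]
  inv_hom_id := by rw [← overScalar_mul, h, overScalar_one]

/-- **The local isomorphism of a coboundary** over its refining open `W_x`:
`(E⟨c⟩)|_{W_x} ≅ E|_{W_x} —(λ_x ·)→ E|_{W_x} ≅ (E⟨c′⟩)|_{W_x}`, i.e. `s = s_x ⊗ t_x ↦ (λ_x s_x) ⊗ t′_x`
(`twistTrivOver` of file #14 twice, `overScalar λ_x` in between). [cite: Hartshorne1977, III Ex. 4.5] -/
def cobLocalHom (x : X) : (twist c E).over (b.W x) ⟶ (twist c' E).over (b.W x) :=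
  (twistTrivOver c E x (b.W x) (b.le x)).inv ≫ overScalar E (b.W x) (b.lam x (b.W x) le_rfl) ≫
    (twistTrivOver c' E x (b.W x) (b.le' x)).hom

/-- Values of the local isomorphism: `s ↦ (λ_x|_V · s_x) ⊗ t′_x` over `V ≤ W_x`. [folklore] -/
theorem appLE_cobLocalHom (x : X) {V : X.Opens} (k : V ⟶ b.W x) (s : Γ(twist c E, V)) :
    appLE (cobLocalHom b E x) k s =
      trivSection c' E x (k.le.trans (b.le' x))
        (X.presheaf.map k.op (b.lam x (b.W x) le_rfl) •
          E.presheaf.map (homOfLE (le_inf le_rfl (k.le.trans (b.le x)) : V ≤ V ⊓ c.U x)).op (comp c E s x)) :=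
  rfl

/-- **The local isomorphisms agree on overlaps** `W_x ∩ W_y` — this is where the coboundary relation
`g′_{xy} λ_y = λ_x g_{xy}` is used: the `z`-coordinates of the two images of `s` over `V ≤ W_x ∩ W_y` are
`g′_{zx} λ_x s_x = g′_{zx} λ_x g_{xy} s_y` and `g′_{zy} λ_y s_y`, and `g′_{zx} λ_x g_{xy} = g′_{zx} g′_{xy} λ_y = g′_{zy} λ_y`.
[cite: Hartshorne1977, III Ex. 4.5] -/
theorem cobLocalHom_compatible (x y : X) :
    restrictHom (Opens.infLELeft (b.W x) (b.W y)) (cobLocalHom b E x) =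
      restrictHom (Opens.infLERight (b.W x) (b.W y)) (cobLocalHom b E y) := by
  refine hom_ext_of_appLE fun V k s => ?_
  rw [appLE_restrictHom, appLE_restrictHom, appLE_cobLocalHom, appLE_cobLocalHom]
  refine twist_ext c' E fun z => ?_
  -- the overlap open `W₀ = V ∩ U′_z` on which the `z`-coordinates live, and its position
  have hW : V ⊓ c'.U z ≤ V := inf_le_left
  have hxW : V ⊓ c'.U z ≤ b.W x := hW.trans (k.le.trans inf_le_left)
  have hyW : V ⊓ c'.U z ≤ b.W y := hW.trans (k.le.trans inf_le_right)
  have hx : V ⊓ c'.U z ≤ c.U x := hxW.trans (b.le x)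
  have hy : V ⊓ c'.U z ≤ c.U y := hyW.trans (b.le y)
  have hx' : V ⊓ c'.U z ≤ c'.U x := hxW.trans (b.le' x)
  have hy' : V ⊓ c'.U z ≤ c'.U y := hyW.trans (b.le' y)
  -- the twisting relation of `s` at `(x, y)` and the coboundary relation, both read over `W₀`
  have key := comp_rel c E s x y hW hx hy
  have rel := b.rel x y (V ⊓ c'.U z) hxW hyW
  have hlamx : X.presheaf.map (homOfLE (inf_le_left : V ⊓ c'.U z ≤ V)).op
      (X.presheaf.map (k ≫ Opens.infLELeft (b.W x) (b.W y)).op (b.lam x (b.W x) le_rfl)) =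
        b.lam x (V ⊓ c'.U z) hxW := by
    rw [map_lam_apply, map_lam_apply]
  have hlamy : X.presheaf.map (homOfLE (inf_le_left : V ⊓ c'.U z ≤ V)).op
      (X.presheaf.map (k ≫ Opens.infLERight (b.W x) (b.W y)).op (b.lam y (b.W y) le_rfl)) =
        b.lam y (V ⊓ c'.U z) hyW := by
    rw [map_lam_apply, map_lam_apply]
  have hscal : c'.g z x (V ⊓ c'.U z) inf_le_right hx' * b.lam x (V ⊓ c'.U z) hxW * c.g x y (V ⊓ c'.U z) hx hy =
      c'.g z y (V ⊓ c'.U z) inf_le_right hy' * b.lam y (V ⊓ c'.U z) hyW := by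
    rw [mul_assoc, ← rel, ← mul_assoc, c'.g_mul]
  rw [comp_trivSection, comp_trivSection, Scheme.Modules.map_smul, Scheme.Modules.map_smul, presheaf_map_map_homOfLE,
    presheaf_map_map_homOfLE, hlamx, hlamy, key, smul_smul, smul_smul, smul_smul, hscal]

/-- **`φ_x ≫ φ_x⁻¹ = 𝟙`** for the local isomorphism of `b` followed by that of the reversed coboundary `b.symm`
(`λ_x λ_x⁻¹ = 1`). [folklore] -/
theorem cobLocalHom_comp_symm (x : X) : cobLocalHom b E x ≫ cobLocalHom b.symm E x = 𝟙 _ := by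
  change ((twistTrivOver c E x (b.W x) (b.le x)).inv ≫ overScalar E (b.W x) (b.lam x (b.W x) le_rfl) ≫
      (twistTrivOver c' E x (b.W x) (b.le' x)).hom) ≫
    ((twistTrivOver c' E x (b.W x) (b.le' x)).inv ≫ overScalar E (b.W x) (b.inv x (b.W x) le_rfl) ≫
      (twistTrivOver c E x (b.W x) (b.le x)).hom) = 𝟙 _
  simp only [Category.assoc, Iso.hom_inv_id_assoc]
  rw [← Category.assoc (overScalar E (b.W x) _), ← overScalar_mul, mul_comm, b.lam_mul_inv, overScalar_one,
    Category.id_comp, Iso.inv_hom_id]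

/-- The inverse local isomorphism `(E⟨c′⟩)|_{W_x} ⟶ (E⟨c⟩)|_{W_x}` (the local isomorphism of `b.symm`, retyped onto the
opens `W_x` of `b`). [folklore] -/
def cobLocalInv (x : X) : (twist c' E).over (b.W x) ⟶ (twist c E).over (b.W x) :=
  cobLocalHom b.symm E x

/-- The inverse local isomorphisms agree on overlaps. [folklore] -/
theorem cobLocalInv_compatible (x y : X) :
    restrictHom (Opens.infLELeft (b.W x) (b.W y)) (cobLocalInv b E x) =
      restrictHom (Opens.infLERight (b.W x) (b.W y)) (cobLocalInv b E y) :=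
  cobLocalHom_compatible b.symm E x y

/-- `φ_x ≫ φ_x⁻¹ = 𝟙`. [folklore] -/
theorem cobLocalHom_comp_inv (x : X) : cobLocalHom b E x ≫ cobLocalInv b E x = 𝟙 _ :=
  cobLocalHom_comp_symm b E x

/-- `φ_x⁻¹ ≫ φ_x = 𝟙`. [folklore] -/
theorem cobLocalInv_comp_hom (x : X) : cobLocalInv b E x ≫ cobLocalHom b E x = 𝟙 _ :=
  cobLocalHom_comp_symm b.symm E x

/-- **The glued isomorphism over the covering open `⨆ W_x`** (`Modules/SheafHom.glueHom` of the compatible families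
`φ_x`, `φ_x⁻¹`; the two composites are gluings of identities). [cite: Hartshorne1977, II Ex. 1.22 and III Ex. 4.5] -/
def twistCongrOver : (twist c E).over (iSup b.W) ≅ (twist c' E).over (iSup b.W) where
  hom := glueHom b.W (cobLocalHom b E) (cobLocalHom_compatible b E)
  inv := glueHom b.W (cobLocalInv b E) (cobLocalInv_compatible b E)
  hom_inv_id := by
    have hid : ∀ x y : X, restrictHom (Opens.infLELeft (b.W x) (b.W y)) (𝟙 ((twist c E).over (b.W x))) =
        restrictHom (Opens.infLERight (b.W x) (b.W y)) (𝟙 ((twist c E).over (b.W y))) := fun x y => by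
      rw [restrictHom_id, restrictHom_id]
    have e1 : glueHom b.W (cobLocalHom b E) (cobLocalHom_compatible b E) ≫
        glueHom b.W (cobLocalInv b E) (cobLocalInv_compatible b E) = glueHom b.W (fun x => 𝟙 _) hid :=
      eq_glueHom _ _ _ _ fun x => by
        rw [restrictHom_comp, restrictHom_glueHom, restrictHom_glueHom, cobLocalHom_comp_inv]
    have e2 : (𝟙 _ : (twist c E).over (iSup b.W) ⟶ _) = glueHom b.W (fun x => 𝟙 _) hid :=
      eq_glueHom _ _ _ _ fun x => restrictHom_id _
    rw [e1, ← e2]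
  inv_hom_id := by
    have hid : ∀ x y : X, restrictHom (Opens.infLELeft (b.W x) (b.W y)) (𝟙 ((twist c' E).over (b.W x))) =
        restrictHom (Opens.infLERight (b.W x) (b.W y)) (𝟙 ((twist c' E).over (b.W y))) := fun x y => by
      rw [restrictHom_id, restrictHom_id]
    have e1 : glueHom b.W (cobLocalInv b E) (cobLocalInv_compatible b E) ≫
        glueHom b.W (cobLocalHom b E) (cobLocalHom_compatible b E) = glueHom b.W (fun x => 𝟙 _) hid :=
      eq_glueHom _ _ _ _ fun x => by
        rw [restrictHom_comp, restrictHom_glueHom, restrictHom_glueHom, cobLocalInv_comp_hom]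
    have e2 : (𝟙 _ : (twist c' E).over (iSup b.W) ⟶ _) = glueHom b.W (fun x => 𝟙 _) hid :=
      eq_glueHom _ _ _ _ fun x => restrictHom_id _
    rw [e1, ← e2]

/-- **WHICH TWIST: cohomologous cocycles give isomorphic twists.** For a Čech coboundary `b` between unit cocycles
`c`, `c′` on a scheme `X` (`g′_{xy} λ_y = λ_x g_{xy}` on a common point-indexed refinement) and ANY `𝒪_X`-module `E`,
`E⟨c⟩ ≅ E⟨c′⟩` — the isomorphism over `⨆ W_x = X` descended along `Modules/RankOneCocycle.isoOfOverCover`.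
[cite: Hartshorne1977, III Ex. 4.5] -/
def twistCongr : twist c E ≅ twist c' E :=
  isoOfOverCover b.mem (twistCongrOver b E)

/-- **Sections of `twistCongr`**: over `V ≤ W_x` the isomorphism is the local one, `s ↦ (λ_x · s_x) ⊗ t′_x`.
[folklore] -/
theorem twistCongr_hom_app (x : X) {V : X.Opens} (hV : V ≤ b.W x) (s : Γ(twist c E, V)) :
    (twistCongr b E).hom.app V s = appLE (cobLocalHom b E x) (homOfLE hV) s := by
  change appLE (glueHom b.W (cobLocalHom b E) (cobLocalHom_compatible b E)) (homOfLE _) s = _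
  rw [appLE_glueHom]
  exact glueValue_eq_appLE b.W (cobLocalHom b E) (cobLocalHom_compatible b E) x (homOfLE hV) _ s

/-- Sections of the inverse: over `V ≤ W_x`, `s′ ↦ (λ_x⁻¹ · s′_x) ⊗ t_x`. [folklore] -/
theorem twistCongr_inv_app (x : X) {V : X.Opens} (hV : V ≤ b.W x) (s : Γ(twist c' E, V)) :
    (twistCongr b E).inv.app V s = appLE (cobLocalHom b.symm E x) (homOfLE hV) s := by
  change appLE (glueHom b.W (cobLocalInv b E) (cobLocalInv_compatible b E)) (homOfLE _) s = _
  rw [appLE_glueHom]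
  exact glueValue_eq_appLE b.W (cobLocalInv b E) (cobLocalInv_compatible b E) x (homOfLE hV) _ s

/-! ### 2. Naturality in `E`: an isomorphism of twist functors -/

variable {E} {F : X.Modules}

/-- The local isomorphisms are natural in the module: `φ_x((φ⟨c⟩) s) = (φ⟨c′⟩)(φ_x s)` (both have `z`-coordinate
`g′_{zx} λ_x φ(s_x)`). [folklore] -/
theorem appLE_cobLocalHom_twistMap (x : X) {V : X.Opens} (k : V ⟶ b.W x) (φ : E ⟶ F) (s : Γ(twist c E, V)) :
    appLE (cobLocalHom b F x) k ((twistMap c φ).app V s) = (twistMap c' φ).app V (appLE (cobLocalHom b E x) k s) := by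
  rw [appLE_cobLocalHom, appLE_cobLocalHom]
  refine twist_ext c' F fun z => ?_
  simp only [comp_trivSection, comp_twistMap_app, Scheme.Modules.Hom.app_smul, ← app_map_apply]

variable (E) in
/-- **`twistCongr` is natural in the module**: `φ⟨c⟩ ≫ twistCongr_F = twistCongr_E ≫ φ⟨c′⟩` (checked locally on the
cover `V ∩ W_x`, where both sides are the local isomorphism). [folklore] -/
theorem twistCongr_hom_naturality (φ : E ⟶ F) :
    twistMap c φ ≫ (twistCongr b F).hom = (twistCongr b E).hom ≫ twistMap c' φ := by
  refine Scheme.Modules.hom_ext _ _ fun V => ?_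
  ext s : 2
  apply TopCat.Sheaf.eq_of_locally_eq' (⟨(twist c' F).presheaf, Scheme.Modules.isSheaf _⟩ : TopCat.Sheaf Ab X)
    (fun x : X => V ⊓ b.W x) V (fun x => homOfLE inf_le_left) (fun v hv => Opens.mem_iSup.mpr ⟨v, ⟨hv, b.mem v⟩⟩)
  intro x
  change (twist c' F).presheaf.map (homOfLE inf_le_left).op ((twistMap c φ ≫ (twistCongr b F).hom).app V s) =
    (twist c' F).presheaf.map (homOfLE inf_le_left).op (((twistCongr b E).hom ≫ twistMap c' φ).app V s)
  rw [Scheme.Modules.Hom.comp_app, Scheme.Modules.Hom.comp_app, CategoryTheory.comp_apply,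
    CategoryTheory.comp_apply, app_map_apply (twistCongr b F).hom, app_map_apply (twistMap c φ),
    app_map_apply (twistMap c' φ), app_map_apply (twistCongr b E).hom, twistCongr_hom_app b F x inf_le_right,
    twistCongr_hom_app b E x inf_le_right, appLE_cobLocalHom_twistMap]

variable (X c c') in
/-- **The twist FUNCTORS of cohomologous cocycles are isomorphic**: `(- ⊗ lineBundle c) ≅ (- ⊗ lineBundle c′)` as
additive endofunctors of `Mod(𝒪_X)`. [cite: Hartshorne1977, III Ex. 4.5] -/
def twistFunctorCongr (b : UnitCocycle.Coboundary c c') : twistFunctor X c ≅ twistFunctor X c' :=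
  NatIso.ofComponents (fun E => twistCongr b E) fun φ => twistCongr_hom_naturality b _ φ

end Local

/-! ### 3. Corollaries: the class and the cover -/

section Corollaries

variable {c c' : UnitCocycle X} (E : X.Modules)

/-- **`[c] = [c′]` (as a coboundary witness up to `Nonempty`) ⇒ `E⟨c⟩ ≅ E⟨c′⟩`.** [cite: Hartshorne1977, III Ex. 4.5] -/
theorem nonempty_twist_iso_of_equiv (h : UnitCocycle.Equiv c c') : Nonempty (twist c E ≅ twist c' E) := by
  obtain ⟨b⟩ := h
  exact ⟨twistCongr b E⟩

/-- **The twist factors through `CechPic X = Ȟ¹(X, 𝒪_X^×)` up to isomorphism**: equal classes give isomorphic twists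
of every module. [cite: Hartshorne1977, III Ex. 4.5] -/
theorem nonempty_twist_iso_of_mk_eq_mk (h : CechPic.mk c = CechPic.mk c') : Nonempty (twist c E ≅ twist c' E) :=
  nonempty_twist_iso_of_equiv E ((CechPic.mk_eq_mk_iff c c').1 h)

variable (c)

/-- **Refining the cover of a cocycle**: the same transition functions `g_{xy}` on a point-indexed refinement
`W_x ≤ U_x` (Hartshorne III Ex. 4.4). [cite: Hartshorne1977, III Ex. 4.4] -/
def refineCocycle (W : X → X.Opens) (mem : ∀ x, x ∈ W x) (le : ∀ x, W x ≤ c.U x) : UnitCocycle X where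
  U := W
  mem := mem
  g x y V hx hy := c.g x y V (hx.trans (le x)) (hy.trans (le y))
  map_g x y _ _ hx hy i := c.map_g x y (hx.trans (le x)) (hy.trans (le y)) i
  g_mul x y z V _ _ _ := c.g_mul x y z V _ _ _
  g_self x V _ := c.g_self x V _

/-- The tautological coboundary (`λ = 1`) from a cocycle to its refinement. [cite: Hartshorne1977, III Ex. 4.4] -/
def refineCoboundary (W : X → X.Opens) (mem : ∀ x, x ∈ W x) (le : ∀ x, W x ≤ c.U x) :
    UnitCocycle.Coboundary c (refineCocycle c W mem le) where
  W := W
  mem := mem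
  le := le
  le' _ := le_rfl
  lam _ _ _ := 1
  inv _ _ _ := 1
  map_lam _ _ _ _ _ := map_one _
  lam_mul_inv _ _ _ := mul_one 1
  rel x y V _ _ := by
    rw [mul_one, one_mul]
    rfl

/-- Refinement does not change the class in `Ȟ¹(X, 𝒪_X^×)`. [cite: Hartshorne1977, III Ex. 4.4] -/
theorem mk_refineCocycle (W : X → X.Opens) (mem : ∀ x, x ∈ W x) (le : ∀ x, W x ≤ c.U x) :
    CechPic.mk (refineCocycle c W mem le) = CechPic.mk c :=
  (CechPic.sound ⟨refineCoboundary c W mem le⟩).symm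

/-- **COVER INDEPENDENCE of the twist**: `E⟨c⟩ ≅ E⟨c|_W⟩` for any point-indexed refinement `W_x ≤ U_x` of the cover
— the twist does not see the cover on which the cocycle is written. [cite: Hartshorne1977, III Ex. 4.4–4.5] -/
def twistRefineIso (W : X → X.Opens) (mem : ∀ x, x ∈ W x) (le : ∀ x, W x ≤ c.U x) :
    twist c E ≅ twist (refineCocycle c W mem le) E :=
  twistCongr (refineCoboundary c W mem le) E

end Corollaries

end CocycleTwist

end Summit.Ventures.HSemireg

end
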